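import Literature.MathematicalPhysics.QuantumFieldTheory.Balaban1983to89.InfiniteVolumeSufficientIII
import Literature.MathematicalPhysics.QuantumLattice.ContinuumLimitLGT
import Literature.MathematicalPhysics.QuantumLattice.LatticeGaugeDLRGibbsProofs
import HarnessLib

/-!
# Robust ball (Y2), area-law side — THE STRONG-COUPLING FREE-ENERGY LAW, I: torus pressure calculus and limit states

HONEST FRAMING: venture file of the cell `pub-ymgap` (QuantumFields programme), track ROBUST-BALL, seat rb-p2 (g7).  LATTICE
statements about Wilson's lattice gauge theory on the tori `(ℤ/(L+1)ℤ)^d` for an arbitrary compact second-countable gauge group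
`G` and a continuous representation `ρ` (tree objects: `wilsonAction`, `wilsonMeasure`, `wilsonExpectation`,
`torusLogPartition`, `infiniteVolumeLimitPoints`, `plaquetteObs`).  This file is the torus half of the free-energy law
(`FreeEnergyLaw.lean`): nothing here is specific to strong coupling, and nothing is continuum / spectral / Clay.

WHAT IS PROVED (everything, no definitions, no named facts):
* ★ `hasDerivAt_torusPressure` — the pressure per site `s ↦ |Λ_{L+1}|⁻¹ log Z_{Λ_{L+1}, s}` is differentiable in the coupling
  with derivative `∑_{i<j} ⟨Re tr ρ(U_{(0,i,j)})⟩_{Λ_{L+1}, s} − #planes · N` (the torus log-partition function is the cumulant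
  generating function of `−S_W` under product Haar, tree `torusLogPartition_eq_cgf`; Mathlib `integral_tilted_mul_self` through
  the tree's `Missing.hasDerivAt_finiteVolumePressure`; translation invariance of the torus state
  `wilsonExpectation_comp_torusConfigShift` turns `−⟨S_W⟩` into `|Λ|` times the plane sum, `wilsonExpectation_neg_wilsonAction`);
* `continuous_planeSum` (analyticity of the cumulant generating function) and ★ `torusPressure_eq_integral` — the fundamental
  theorem of calculus: `|Λ_{L+1}|⁻¹ log Z_{Λ_{L+1}, β} = ∫₀^β ∑_{i<j} ⟨Re tr ρ(U_{(0,i,j)})⟩_{Λ_{L+1}, s} ds − #planes·N·β`;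
* `exists_isInfiniteVolumeLimitAlong_comp` — along EVERY sequence of torus sizes the torus states have a subsequential
  infinite-volume limit state (compactness, as in the tree's `infiniteVolumeLimitPoints_nonempty_holds`), whence
  ★ `eventually_planeSum_le` / `eventually_le_planeSum`: a bound on the plane sum of plaquette expectations valid for ALL
  limit states at coupling `s` bounds the torus plane sum at `s` eventually in `L`, up to any `ε > 0`.

References: S. Friedli, Y. Velenik, *Statistical Mechanics of Lattice Systems* (CUP 2017), §3.2 (pressure, energy density
as its derivative); E. Seiler, LNP 159 (1982), Ch. 2.  Everything here is proved. [folklore]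
-/

noncomputable section

open MeasureTheory Filter Topology Finset ProbabilityTheory
open Literature.MathematicalPhysics.QuantumLattice
open Literature.MathematicalPhysics.QuantumFieldTheory hiding ZdEdge

namespace Summit.Ventures.YMGap.RobustBall

namespace FreeEnergyLaw

/-! ### The torus pressure and its coupling derivative in plaquette form -/

section Algebra

variable {d N : ℕ} {G : Type*} [Group G] (ρ : G →* Matrix (Fin N) (Fin N) ℂ)

/-- The torus plaquette observable at the origin of the `(i, j)` plane is the torus restriction of the `ℤ^d` plaquette
observable: `(plaquetteObs ρ 0 i j) ∘ torusLift L = Re tr ρ(U_{(0,i,j)})`. [folklore] -/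
theorem toTorusObservable_plaquetteObs_zero (L : ℕ) (i j : Fin d) (U : GaugeConfig d L G) :
    toTorusObservable L (plaquetteObs ρ (0 : Literature.Probability.LatticeModels.Site d) i j) U =
      (ρ (plaquetteHolonomy U 0 i j)).trace.re := by
  rw [toTorusObservable_apply, plaquetteObs, FreeEnergy.plaquetteHolonomyZd_torusLift]
  have h0 : Literature.Probability.LatticeModels.Torus.proj L (0 : Literature.Probability.LatticeModels.Site d) = 0 := by
    funext k; simp [Literature.Probability.LatticeModels.Torus.proj]
  rw [h0]

/-- Every torus plaquette observable is a translate of the one at the origin of its plane: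
`Re tr ρ(U_{(x,i,j)}) = ((plaquetteObs ρ 0 i j) ∘ torusLift L) (θ_{−x} U)`. [folklore] -/
theorem plaquette_eq_toTorusObservable_shift [MeasurableSpace G] (L : ℕ) (x : Site d L) (i j : Fin d)
    (U : GaugeConfig d L G) :
    (ρ (plaquetteHolonomy U x i j)).trace.re =
      (toTorusObservable L (plaquetteObs ρ (0 : Literature.Probability.LatticeModels.Site d) i j) ∘
        torusConfigShift (-x)) U := by
  rw [Function.comp_apply, toTorusObservable_plaquetteObs_zero, plaquetteHolonomy_torusConfigShift, zero_sub, neg_neg]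

end Algebra

section Torus

variable {d N : ℕ} {G : Type*} [Group G] [TopologicalSpace G] [IsTopologicalGroup G]
  [CompactSpace G] [MeasurableSpace G] [BorelSpace G] [SecondCountableTopology G]
  (ρ : G →* Matrix (Fin N) (Fin N) ℂ)

omit [CompactSpace G] [MeasurableSpace G] [BorelSpace G] [SecondCountableTopology G] in
/-- The torus plaquette observables are continuous. [folklore] -/
theorem continuous_toTorusObservable_plaquetteObs (hρ : Continuous ρ) (L : ℕ) (i j : Fin d) :
    Continuous (toTorusObservable L (plaquetteObs (G := G) ρ (0 : Literature.Probability.LatticeModels.Site d) i j)) :=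
  (continuous_plaquetteObs ρ hρ _ _ _).comp (continuous_torusLift L)

/-- The plane sum of the torus plaquette expectations at coupling `s`:
`A_L(s) = ∑_{i<j} ⟨Re tr ρ(U_{(0,i,j)})⟩_{Λ_{L}, s}` (local notation-free helper statement: the Wilson expectation of
`−S_W` is `|Λ_L| (A_L(s) − N · #planes)`). [folklore] -/
theorem wilsonExpectation_neg_wilsonAction (hρ : Continuous ρ) (s : ℝ) (L : ℕ) [NeZero L] :
    wilsonExpectation (L := L) ρ s (fun U : GaugeConfig d L G => -wilsonAction ρ U) =
      (Fintype.card (Site d L) : ℝ) *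
        ((∑ q : {q : Fin d × Fin d // q.1 < q.2},
            wilsonExpectation (L := L) ρ s
              (toTorusObservable L (plaquetteObs ρ (0 : Literature.Probability.LatticeModels.Site d) q.1.1 q.1.2))) -
          (Fintype.card {q : Fin d × Fin d // q.1 < q.2} : ℝ) * N) := by
  haveI := isProbabilityMeasure_wilsonMeasure (d := d) (L := L) ρ hρ s
  -- continuity / integrability of the torus plaquette observables
  have hcont : ∀ (x : Site d L) (i j : Fin d),
      Continuous fun U : GaugeConfig d L G => (ρ (plaquetteHolonomy U x i j)).trace.re := by
    intro x i j
    have h := continuous_toTorusObservable_plaquetteObs ρ hρ L i j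
    have hsh : Continuous fun U : GaugeConfig d L G => torusConfigShift (-x) U :=
      continuous_pi fun e => by simp only [torusConfigShift_apply]; exact continuous_apply _
    refine (h.comp hsh).congr fun U => ?_
    exact (plaquette_eq_toTorusObservable_shift ρ L x i j U).symm
  have hint : ∀ p : Plaquette d L, Integrable
      (fun U : GaugeConfig d L G => (ρ (plaquetteHolonomy U p.1 p.2.1.1 p.2.1.2)).trace.re)
      (wilsonMeasure (d := d) (L := L) ρ s) := fun p =>
    (hcont p.1 p.2.1.1 p.2.1.2).integrable_of_hasCompactSupport (HasCompactSupport.of_compactSpace _)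
  -- each torus plaquette expectation equals the one at the origin of its plane
  have hplaq : ∀ (x : Site d L) (q : {q : Fin d × Fin d // q.1 < q.2}),
      ∫ U, (ρ (plaquetteHolonomy U x q.1.1 q.1.2)).trace.re ∂(wilsonMeasure (d := d) (L := L) ρ s) =
        ∫ U, toTorusObservable L (plaquetteObs ρ (0 : Literature.Probability.LatticeModels.Site d) q.1.1 q.1.2) U
          ∂(wilsonMeasure (d := d) (L := L) ρ s) := by
    intro x q
    have h := wilsonExpectation_comp_torusConfigShift (d := d) (L := L) ρ s (-x)
      (toTorusObservable L (plaquetteObs ρ (0 : Literature.Probability.LatticeModels.Site d) q.1.1 q.1.2))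
    unfold wilsonExpectation at h
    rw [← h]
    refine integral_congr_ae (ae_of_all _ fun U => ?_)
    exact plaquette_eq_toTorusObservable_shift ρ L x q.1.1 q.1.2 U
  have hneg : (fun U : GaugeConfig d L G => -wilsonAction ρ U) =
      fun U => ∑ p : Plaquette d L, ((ρ (plaquetteHolonomy U p.1 p.2.1.1 p.2.1.2)).trace.re - (N : ℝ)) := by
    funext U
    simp only [wilsonAction, ← Finset.sum_neg_distrib, neg_sub]
  have hsub : ∀ p : Plaquette d L,
      ∫ U, ((ρ (plaquetteHolonomy U p.1 p.2.1.1 p.2.1.2)).trace.re - (N : ℝ)) ∂(wilsonMeasure (d := d) (L := L) ρ s) =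
        (∫ U, (ρ (plaquetteHolonomy U p.1 p.2.1.1 p.2.1.2)).trace.re ∂(wilsonMeasure (d := d) (L := L) ρ s)) - N := by
    intro p
    rw [integral_sub (hint p) (integrable_const _), integral_const, smul_eq_mul, probReal_univ, one_mul]
  unfold wilsonExpectation
  rw [hneg, integral_finsetSum Finset.univ
    (f := fun (p : Plaquette d L) (U : GaugeConfig d L G) =>
      (ρ (plaquetteHolonomy U p.1 p.2.1.1 p.2.1.2)).trace.re - (N : ℝ))
    fun p _ => (hint p).sub (integrable_const _)]
  simp_rw [hsub]
  rw [Finset.sum_sub_distrib, Finset.sum_const, Finset.card_univ, nsmul_eq_mul, Fintype.sum_prod_type]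
  simp_rw [hplaq]
  rw [Finset.sum_const, Finset.card_univ, nsmul_eq_mul, Fintype.card_prod]
  push_cast
  ring

/-- ★ **The coupling derivative of the torus pressure in plaquette form.**  For continuous `ρ` and every torus side
`L + 1`, the pressure per site `s ↦ |Λ_{L+1}|⁻¹ log Z_{Λ_{L+1}, s}` is differentiable with derivative
`∑_{i<j} ⟨Re tr ρ(U_{(0,i,j)})⟩_{Λ_{L+1}, s} − #planes · N` (cumulant generating function of `−S_W` under product Haar,
Mathlib `integral_tilted_mul_self`, translation invariance of the torus state). [folklore] -/
theorem hasDerivAt_torusPressure (hρ : Continuous ρ) (L : ℕ) (s : ℝ) :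
    HasDerivAt (fun s : ℝ => (((L + 1 : ℕ) : ℝ) ^ d)⁻¹ * torusLogPartition d ρ s (L + 1))
      ((∑ q : {q : Fin d × Fin d // q.1 < q.2},
          wilsonExpectation (L := L + 1) ρ s
            (toTorusObservable (L + 1) (plaquetteObs ρ (0 : Literature.Probability.LatticeModels.Site d) q.1.1 q.1.2))) -
        (Fintype.card {q : Fin d × Fin d // q.1 < q.2} : ℝ) * N) s := by
  have hH : Measurable fun U : GaugeConfig d (L + 1) G => -wilsonAction ρ U := (WilsonRP.measurable_wilsonAction ρ hρ).neg
  obtain ⟨B, hB⟩ := exists_abs_wilsonAction_le (d := d) (L := L + 1) ρ hρ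
  have hB' : ∀ U : GaugeConfig d (L + 1) G, |-wilsonAction ρ U| ≤ B := fun U => by rw [abs_neg]; exact hB U
  have hd := Balaban1983to89.Missing.hasDerivAt_finiteVolumePressure
    (Ω := fun L : ℕ => GaugeConfig d (L + 1) G)
    (μ := fun L : ℕ => Measure.pi fun _ : Edge d (L + 1) => haarProbability G)
    (H := fun (L : ℕ) (U : GaugeConfig d (L + 1) G) => -wilsonAction ρ U)
    (V := fun L : ℕ => (((L + 1 : ℕ) : ℝ) ^ d)) L hH hB' s
  have hfun : (fun J : ℝ => ((((L + 1 : ℕ) : ℝ) ^ d))⁻¹ *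
      cgf (fun U : GaugeConfig d (L + 1) G => -wilsonAction ρ U)
        (Measure.pi fun _ : Edge d (L + 1) => haarProbability G) J) =
      fun J : ℝ => (((L + 1 : ℕ) : ℝ) ^ d)⁻¹ * torusLogPartition d ρ J (L + 1) := by
    funext J
    rw [torusLogPartition_eq_cgf ρ hρ J]
  have htilt : ((Measure.pi fun _ : Edge d (L + 1) => haarProbability G).tilted
      fun U : GaugeConfig d (L + 1) G => s * -wilsonAction ρ U) = wilsonMeasure (d := d) (L := L + 1) ρ s := by
    rw [wilsonMeasure_eq_tilted_pi ρ hρ s]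
    congr 1
    funext U
    ring
  have hval : (((L + 1 : ℕ) : ℝ) ^ d)⁻¹ *
      ∫ U, -wilsonAction ρ U ∂((Measure.pi fun _ : Edge d (L + 1) => haarProbability G).tilted
        fun U : GaugeConfig d (L + 1) G => s * -wilsonAction ρ U) =
      (∑ q : {q : Fin d × Fin d // q.1 < q.2},
          wilsonExpectation (L := L + 1) ρ s
            (toTorusObservable (L + 1) (plaquetteObs ρ (0 : Literature.Probability.LatticeModels.Site d) q.1.1 q.1.2))) -
        (Fintype.card {q : Fin d × Fin d // q.1 < q.2} : ℝ) * N := by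
    rw [htilt]
    have h := wilsonExpectation_neg_wilsonAction (d := d) ρ hρ s (L + 1)
    unfold wilsonExpectation at h ⊢
    have hcard : (Fintype.card (Site d (L + 1)) : ℝ) = ((L + 1 : ℕ) : ℝ) ^ d := by
      rw [Fintype.card_fun, ZMod.card, Fintype.card_fin]; push_cast; ring
    rw [h, hcard, ← mul_assoc, inv_mul_cancel₀ (by positivity), one_mul]
  rw [hfun, hval] at hd
  exact hd

/-- The plane sum of torus plaquette expectations `s ↦ ∑_{i<j} ⟨Re tr ρ(U_{(0,i,j)})⟩_{Λ_{L+1}, s}` is continuous in the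
coupling (it is, up to constants, the derivative of the analytic cumulant generating function of `−S_W`). [folklore] -/
theorem continuous_planeSum (hρ : Continuous ρ) (L : ℕ) :
    Continuous fun s : ℝ => ∑ q : {q : Fin d × Fin d // q.1 < q.2},
      wilsonExpectation (L := L + 1) ρ s
        (toTorusObservable (L + 1) (plaquetteObs ρ (0 : Literature.Probability.LatticeModels.Site d) q.1.1 q.1.2)) := by
  set P : ℝ → ℝ := fun s => (((L + 1 : ℕ) : ℝ) ^ d)⁻¹ * torusLogPartition d ρ s (L + 1) with hP
  have hH : Measurable fun U : GaugeConfig d (L + 1) G => -wilsonAction ρ U := (WilsonRP.measurable_wilsonAction ρ hρ).neg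
  obtain ⟨B, hB⟩ := exists_abs_wilsonAction_le (d := d) (L := L + 1) ρ hρ
  have hB' : ∀ U : GaugeConfig d (L + 1) G, |-wilsonAction ρ U| ≤ B := fun U => by rw [abs_neg]; exact hB U
  -- `P` is analytic (a constant multiple of a cumulant generating function of a bounded variable)
  have han : ∀ s, AnalyticAt ℝ P s := by
    intro s
    have hI : integrableExpSet (fun U : GaugeConfig d (L + 1) G => -wilsonAction ρ U)
        (Measure.pi fun _ : Edge d (L + 1) => haarProbability G) = Set.univ :=
      Set.eq_univ_of_forall fun t => Literature.Probability.LatticeModels.ForbiddenGap.integrable_exp_mul_of_abs_le hH hB' t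
    have hmem : s ∈ interior (integrableExpSet (fun U : GaugeConfig d (L + 1) G => -wilsonAction ρ U)
        (Measure.pi fun _ : Edge d (L + 1) => haarProbability G)) := by
      rw [hI, interior_univ]; exact Set.mem_univ _
    have h := (analyticAt_const (v := (((L + 1 : ℕ) : ℝ) ^ d)⁻¹)).mul (analyticAt_cgf hmem)
    refine h.congr (Filter.Eventually.of_forall fun J => ?_)
    simp only [hP, torusLogPartition_eq_cgf ρ hρ J, Pi.mul_apply]
  have hderiv : deriv P = fun s => (∑ q : {q : Fin d × Fin d // q.1 < q.2},
      wilsonExpectation (L := L + 1) ρ s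
        (toTorusObservable (L + 1) (plaquetteObs ρ (0 : Literature.Probability.LatticeModels.Site d) q.1.1 q.1.2))) -
        (Fintype.card {q : Fin d × Fin d // q.1 < q.2} : ℝ) * N :=
    funext fun s => (hasDerivAt_torusPressure (d := d) ρ hρ L s).deriv
  have hc : Continuous (deriv P) := continuous_iff_continuousAt.2 fun s => (han s).deriv.continuousAt
  rw [hderiv] at hc
  exact (hc.add (continuous_const (y := (Fintype.card {q : Fin d × Fin d // q.1 < q.2} : ℝ) * N))).congr
    fun s => by simp

/-- ★ **The torus pressure is the coupling integral of the plane sum of plaquette expectations** (fundamental theorem of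
calculus, `log Z_{Λ, 0} = 0`): `|Λ_{L+1}|⁻¹ log Z_{Λ_{L+1}, β} = ∫₀^β ∑_{i<j} ⟨Re tr ρ(U_{(0,i,j)})⟩_{Λ_{L+1}, s} ds − #planes·N·β`.
[folklore] -/
theorem torusPressure_eq_integral (hρ : Continuous ρ) (L : ℕ) (β : ℝ) :
    (((L + 1 : ℕ) : ℝ) ^ d)⁻¹ * torusLogPartition d ρ β (L + 1) =
      (∫ s in (0 : ℝ)..β, ∑ q : {q : Fin d × Fin d // q.1 < q.2},
          wilsonExpectation (L := L + 1) ρ s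
            (toTorusObservable (L + 1) (plaquetteObs ρ (0 : Literature.Probability.LatticeModels.Site d) q.1.1 q.1.2))) -
        (Fintype.card {q : Fin d × Fin d // q.1 < q.2} : ℝ) * N * β := by
  have hftc := intervalIntegral.integral_eq_sub_of_hasDerivAt (a := 0) (b := β)
    (fun s _ => hasDerivAt_torusPressure (d := d) ρ hρ L s)
    (((continuous_planeSum (d := d) ρ hρ L).sub continuous_const).intervalIntegrable 0 β)
  have h0 : torusLogPartition d ρ 0 (L + 1) = 0 := by
    haveI : IsProbabilityMeasure (Measure.pi fun _ : Edge d (L + 1) => haarProbability G) := inferInstance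
    rw [torusLogPartition_eq_cgf ρ hρ 0, cgf_zero]
  rw [h0, mul_zero, sub_zero,
    intervalIntegral.integral_sub ((continuous_planeSum (d := d) ρ hρ L).intervalIntegrable 0 β)
      (continuous_const.intervalIntegrable 0 β),
    intervalIntegral.integral_const, sub_zero, smul_eq_mul] at hftc
  rw [← hftc]
  ring

end Torus

/-! ### Limit states: compactness along subsequences and eventual bounds on the torus plane sums -/

section LimitPoints

variable {d N : ℕ} {G : Type*} [Group G] [TopologicalSpace G] [IsTopologicalGroup G]
  [CompactSpace G] [MeasurableSpace G] [BorelSpace G] [SecondCountableTopology G] [T2Space G]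
  (ρ : G →* Matrix (Fin N) (Fin N) ℂ)

/-- **Along every sequence of torus sizes the torus Wilson states have a subsequential infinite-volume limit state**
(compactness and metrisability of the probability measures on `G^{links(ℤ^d)}`, Lévy–Prokhorov; the argument of the tree's
`infiniteVolumeLimitPoints_nonempty_holds` along an arbitrary sequence `Ls`). [folklore] -/
theorem exists_isInfiniteVolumeLimitAlong_comp (hρ : Continuous ρ) (β : ℝ) (Ls : ℕ → ℕ) :
    ∃ (φ : ℕ → ℕ) (μ : Measure (LGConfig d G)), StrictMono φ ∧ IsInfiniteVolumeLimitAlong ρ β (Ls ∘ φ) μ := by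
  haveI := fun L : ℕ => isProbabilityMeasure_torusState (d := d) (L := L + 1) ρ hρ β
  let P : ℕ → ProbabilityMeasure (LGConfig d G) := fun L => ⟨torusState ρ β (L + 1), inferInstance⟩
  obtain ⟨ν, -, φ, hφ, hlim⟩ :=
    (isCompact_univ (X := ProbabilityMeasure (LGConfig d G))).tendsto_subseq fun n => Set.mem_univ (P (Ls n))
  refine ⟨φ, (ν : Measure (LGConfig d G)), hφ, inferInstance, fun F S _ hFc hFb => ?_⟩
  obtain ⟨C, hC⟩ := hFb
  let Fb : BoundedContinuousFunction (LGConfig d G) ℝ :=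
    BoundedContinuousFunction.ofNormedAddCommGroup F hFc C (fun U => by simpa [Real.norm_eq_abs] using hC U)
  have hE : (fun k : ℕ => wilsonExpectation (L := (Ls ∘ φ) k + 1) ρ β (toTorusObservable ((Ls ∘ φ) k + 1) F)) =
      fun k => ∫ U, Fb U ∂(P (Ls (φ k)) : Measure (LGConfig d G)) :=
    funext fun k => wilsonExpectation_toTorusObservable ρ β ((Ls ∘ φ) k + 1) hFc.measurable
  rw [hE]
  exact (ProbabilityMeasure.tendsto_iff_forall_integral_tendsto.1 hlim) Fb

omit [SecondCountableTopology G] [T2Space G] in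
/-- Along an infinite-volume limit, the torus plane sum of plaquette expectations converges to the plane sum of the
limit state's plaquette expectations. [folklore] -/
theorem tendsto_planeSum (hρ : Continuous ρ) {β : ℝ} {Ls : ℕ → ℕ} {μ : Measure (LGConfig d G)}
    (hμ : IsInfiniteVolumeLimitAlong ρ β Ls μ) :
    Tendsto (fun k : ℕ => ∑ q : {q : Fin d × Fin d // q.1 < q.2},
        wilsonExpectation (L := Ls k + 1) ρ β
          (toTorusObservable (Ls k + 1) (plaquetteObs ρ (0 : Literature.Probability.LatticeModels.Site d) q.1.1 q.1.2)))
      atTop (𝓝 (∑ q : {q : Fin d × Fin d // q.1 < q.2},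
        ∫ U, plaquetteObs ρ (0 : Literature.Probability.LatticeModels.Site d) q.1.1 q.1.2 U ∂μ)) :=
  tendsto_finsetSum _ fun q _ => hμ.2 _ _ (isCylinder_plaquetteObs_zero ρ q.1.1 q.1.2)
    (continuous_plaquetteObs ρ hρ _ _ _) (exists_abs_plaquetteObs_le ρ hρ _ _ _)

/-- ★ **Upper bounds on the plaquettes of ALL limit states bound the torus plane sums eventually.**  If every
infinite-volume limit state at coupling `s` has plane sum of plaquette expectations `≤ B`, then for every `ε > 0` the torus
plane sum `∑_{i<j} ⟨Re tr ρ(U_{(0,i,j)})⟩_{Λ_{L+1}, s}` is `≤ B + ε` for all large `L` (by compactness: otherwise a subsequence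
violating it has a limit state). [folklore] -/
theorem eventually_planeSum_le (hρ : Continuous ρ) {s B ε : ℝ}
    (hB : ∀ μ ∈ infiniteVolumeLimitPoints ρ s, (∑ q : {q : Fin d × Fin d // q.1 < q.2},
      ∫ U, plaquetteObs ρ (0 : Literature.Probability.LatticeModels.Site d) q.1.1 q.1.2 U ∂μ) ≤ B) (hε : 0 < ε) :
    ∀ᶠ L : ℕ in atTop, (∑ q : {q : Fin d × Fin d // q.1 < q.2},
        wilsonExpectation (L := L + 1) ρ s
          (toTorusObservable (L + 1) (plaquetteObs ρ (0 : Literature.Probability.LatticeModels.Site d) q.1.1 q.1.2))) ≤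
      B + ε := by
  by_contra h
  rw [not_eventually] at h
  simp only [not_le] at h
  obtain ⟨φ, hφ, hlt⟩ := extraction_of_frequently_atTop h
  obtain ⟨ψ, μ, hψ, hμ⟩ := exists_isInfiniteVolumeLimitAlong_comp (d := d) ρ hρ s φ
  have hmem : μ ∈ infiniteVolumeLimitPoints ρ s := ⟨φ ∘ ψ, hφ.comp hψ, hμ⟩
  have hge := ge_of_tendsto (tendsto_planeSum (d := d) ρ hρ hμ) (Eventually.of_forall fun k => (hlt (ψ k)).le)
  linarith [hB μ hmem]

/-- ★ **Lower bounds on the plaquettes of ALL limit states bound the torus plane sums eventually from below.** [folklore] -/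
theorem eventually_le_planeSum (hρ : Continuous ρ) {s B ε : ℝ}
    (hB : ∀ μ ∈ infiniteVolumeLimitPoints ρ s, B ≤ ∑ q : {q : Fin d × Fin d // q.1 < q.2},
      ∫ U, plaquetteObs ρ (0 : Literature.Probability.LatticeModels.Site d) q.1.1 q.1.2 U ∂μ) (hε : 0 < ε) :
    ∀ᶠ L : ℕ in atTop, B - ε ≤ ∑ q : {q : Fin d × Fin d // q.1 < q.2},
        wilsonExpectation (L := L + 1) ρ s
          (toTorusObservable (L + 1) (plaquetteObs ρ (0 : Literature.Probability.LatticeModels.Site d) q.1.1 q.1.2)) := by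
  by_contra h
  rw [not_eventually] at h
  simp only [not_le] at h
  obtain ⟨φ, hφ, hlt⟩ := extraction_of_frequently_atTop h
  obtain ⟨ψ, μ, hψ, hμ⟩ := exists_isInfiniteVolumeLimitAlong_comp (d := d) ρ hρ s φ
  have hmem : μ ∈ infiniteVolumeLimitPoints ρ s := ⟨φ ∘ ψ, hφ.comp hψ, hμ⟩
  have hle := le_of_tendsto (tendsto_planeSum (d := d) ρ hρ hμ) (Eventually.of_forall fun k => (hlt (ψ k)).le)
  linarith [hB μ hmem]

end LimitPoints

end FreeEnergyLaw

end Summit.Ventures.YMGap.RobustBall
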